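import Summits.BirchSwinnertonDyer.Rank1Residual.X2.IMCEqOnTreeIntOther
import HarnessLib

/-!
# O9 (X2c, rank one at an Eisenstein `p ‖ N`), line b1 of crux 4 `BSDpOnCellC`: road H, road R-β and
# Keller–Yin D′ RE-ORIENTED — the three typed residual halves of the IMC atom with the X-slot (strict
# prime of `X_ac`) AT THE OTHER PRIME `𝔭̄`, frames at `(ι′, 𝔭)` — and their kernel glue to the
# re-oriented atoms c3♭′ / c3s♭′ of p487050 (cell `bsd-eis`, seat `bsd-eis-c3h` g4; RULINGS L31 (2),
# L32 (C), L33 (F1); erratum item E4 of the littype-05 (C4) verdict)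

HONEST FRAMING (cell `bsd-eis`, run/shared/lean/pub/bsd-eis/): five hypothesis-shaped `@[conjecture]`
predicates + theorems; nothing booked; X2 stays CONSTRUCTION-SHAPED; no label or count moves; BSD is not
proved by any of this. Typed ≠ proved ≠ endorsed.

## Why

The IMC stub of line b1 is being re-registered (skeleton v9) as the conjunction of the RE-ORIENTED
atoms `X2.NonsplitIMCEqOnTreeIntOther W p` / `X2.SplitIMCEqOnTreeIntOther W p` (p487050): for every X2c
Heegner datum and every ♭-frame `Q` at `(ι′, 𝔭)`, `Ch_Λ(X_ac^∅ STRICT AT 𝔭̄)·𝓞_{ℂ_p}⟦T⟧ = (Q)`. That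
atom is CLOSED BY NAME at the PRE tier from Keller–Yin Thm. D (p481783 / p487050). The cell's two typed
ALTERNATIVE roads to the IMC atom — the Kolyvagin road R-β (one divisibility `∃ k, p^k·Q ∈ Ch·𝓞`) and
the Hida-limit road H (the reverse divisibility `∃ a, p^a·𝓕 ∈ (Q)`), each glued to Keller–Yin's D′
(`μ = 0` and `λ`-equality) by the first-unit-coefficient algebra of `X2.CpIntSeries` — were typed with
the X-slot at the frame's own prime `𝔭` (`X2/HidaLimitRoadInt.lean` p429473, `X2/SplitHalvesOnTreeInt.lean`
p432153, `X2/HidaLimitInputsInt.lean`): by RULING L31 (1) / L33 those state halves of the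
`γ ↦ γ⁻¹`-CONJUGATE main conjecture (erratum list E4). RULING L31 (2): "roads H / D′ / Kolyvagin-div
stay the routes to a PUB-tier closure, typed in the SAME orientation". This file is that re-typing —
nothing else:

* `NonsplitKolyvaginDivOnTreeIntOther W p` / `SplitKolyvaginDivOnTreeIntOther W p` (c3♭′-div /
  c3s♭′-div): binders = those of `NonsplitIMCEqOnTreeIntOther` / `SplitIMCEqOnTreeIntOther` VERBATIM
  (the registered atoms' binders + `Odd (discr K)` + `𝔭̄ ∋ p, 𝔭̄ ≠ 𝔭` + `((p)).primesOver.ncard = 2`),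
  conclusion `∃ k, p^k·Q ∈ Ch_Λ(X_ac^∅ strict at 𝔭̄)·𝓞_{ℂ_p}⟦T⟧`;
* `NonsplitMuLambdaOnTreeIntOther W p` / `SplitMuLambdaOnTreeIntOther W p` (D′ at `𝔭̄`): same binders;
  for every generator `𝓕` of `Ch_Λ(X_ac^∅ strict at 𝔭̄)`, the first unit coefficients of `𝓕♭` and of
  `Q` sit at the same index;
* `HidaLimitRevDivOnTreeIntOther W p` (road H at `𝔭̄`, SIGN-FREE as p429473's): same binders minus
  the sign; `∃ a, p^a·𝓕♭ ∈ (Q)`;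
* glue (§2), VERBATIM the p429473 / p432153 proofs with `𝔭 ↦ 𝔭̄` in the X-slot (the algebra
  `X2.CpIntSeries.span_singleton_eq_of_C_pow_mul_mem` is slot-agnostic): either divisibility half + D′
  ⟹ the re-oriented atom, each sign. The companion proof file
  `Theorems/EisensteinPrimesBSDpOnCellCStubC3OtherLinks.lean` (seat c3h g4) carries the consistency
  lemmas (atom ⟹ each divisibility half with `k = 0` / `a = 0` — so every predicate here is
  INTERMEDIATE, never stronger than c3♭′ ∧ c3s♭′), the by-name derivation of both divisibility halves
  from Keller–Yin Thm. D, and the v9 `stub_c3` signature shape from these halves.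

PRINT STATUS of the halves, unchanged by the re-orientation (same sources, same tier): R-β = the
reducible weight-2 Heegner-point Kolyvagin system at `p ‖ N` (Keller–Yin §3 + Castella arXiv:2409.01360
Cor. 2.3 / Prop. 3.2; PRE); D′ = Keller–Yin v2 §5.1 Lemma (μ) + `algmain` (λ) (PRE); road H = Keller–Yin
§5.1 (a)–(e) following Skinner 2016 §3.1 with Castella JIMJ 2020 Thm. 2.11 for (b), as repaired by
bsd-eis-ky MEMO-2 "Thm. D″" (input (α), cgshw MEMO-9) — PRE / unprinted at member level; none of the
three is typable BY NAME at member level today (seat c3h g0 (B2): no weight-`k` anticyclotomic objects in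
the tree). In print's own terms (littype-05 C4 verdict e1a2a1c6, lit §65/§70): the tree's `XAc … 𝔭̄`
with a tree-frame at `(ι′, 𝔭)` is Keller–Yin's `𝔛_f` (relaxed `v`, unramified `v̄`) with `𝓛_f ∈ Λ^nr`
— so `HidaLimitRevDivOnTreeIntOther` is EXACTLY the direction KY §5.1's second Lemma delivers
("`Char(𝔛^S_f)Λ^nr ⊆ (𝓛^S_f)`" read through Lemma 5.1.2), and the Kolyvagin half is KY §3 `Koly`.

What this is NOT: not a proof of any half; not the conjugate-oriented predicates of p429473 / p432153
(untouched; RULING L7: files replace nothing); no statement about CTL, c2 or crux 3; no convention from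
print is invoked.

References: [KellerYin2024] §5.1 (a)–(e), Lemma 5.1.2, Thm. 5.1.3 = Thm. D, §3 (arXiv:2402.12781v2
L1725–L1780; PRE); [Skinner2016PacificMC] §3.1; [Castella2020JIMJ] Thm. 2.11 / §1.5; [Hsieh2014] Thm. 1
and p. 7 (the receptacle); [Washington1997] §7.1 Prop. 7.2, §13.2; cell memos bsd-eis-ky MEMO-2, cgshw
MEMO-8/9, c3h MEMO-1/2, RULINGS L31–L33.
-/

set_option autoImplicit false

noncomputable section

open scoped Classical MatrixGroups ModularForm

open CongruenceSubgroup WeierstrassCurve NumberField IsDedekindDomain Field PowerSeries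
  Literature.NumberTheory.EllipticCurves Literature.NumberTheory.EllipticCurves.GreenbergSelmer
  Literature.NumberTheory.EllipticCurves.ModularForms
  Literature.NumberTheory.EllipticCurves.Rank1Residual
  Literature.NumberTheory.EllipticCurves.Rank1Residual.Typed
  Literature.NumberTheory.GaloisRepresentations Literature.NumberTheory.GaloisCohomology
  Literature.NumberTheory.Automorphic
  Summit.BirchSwinnertonDyer.Rank1Residual.X11b.AcSelmer
  Summit.BirchSwinnertonDyer.Rank1Residual.X11b.Halves
  Summit.BirchSwinnertonDyer.Rank1Residual.X11b

namespace Summit.BirchSwinnertonDyer.Rank1Residual.X2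

/-! ### §1 The re-oriented halves as named predicates (X-slot at `𝔭̄`, frames at `(ι′, 𝔭)`) -/

section ResidualsIntOther

variable (W : WeierstrassCurve ℚ) [W.IsElliptic] [W.IsGloballyMinimal] (p : ℕ) [Fact p.Prime]

/-- **c3♭′-div — `NonsplitKolyvaginDivOnTreeIntOther W p`: ONE DIVISIBILITY (the Kolyvagin direction)
in the anticyclotomic IMC at a NON-split Eisenstein `p ‖ N` over `𝓞_{ℂ_p}`-frames, X-slot AT THE OTHER
PRIME.** Binders = those of `NonsplitIMCEqOnTreeIntOther W p` (p487050) VERBATIM; conclusion: for every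
♭-frame `Q` at `(ι′, 𝔭)`, `∃ k, p^k · Q ∈ Ch_Λ(X_ac^∅(E[p^∞]) STRICT AT 𝔭̄)·𝓞_{ℂ_p}⟦T⟧`. The re-oriented
twin of `NonsplitKolyvaginDivOnTreeInt W p` (p429473, X-slot at `𝔭` = the conjugate statement, RULING
L31/L33). PROVENANCE (road R-β; NOT assembled in refereed print at a reducible `p ‖ N`): the weight-2
reducible Heegner-point Kolyvagin system (Keller–Yin §3 `Koly`) + Castella arXiv:2409.01360 Cor. 2.3 /
Prop. 3.2. TYPED, not attempted; nothing asserted; consumed as a hypothesis.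
[claim: KellerYin2024, status: under-review]
[cite: KellerYin2024, §3 and §5.2 (arXiv:2402.12781v2) (shape only; nothing asserted)]
[cite: Hsieh2014, Thm. 1 and p. 7 (arXiv:1112.1580) (the receptacle `Z̄_p⟦Γ⁻⟧ ⊆ 𝓞_{ℂ_p}⟦T⟧`)] -/
@[conjecture]
def NonsplitKolyvaginDivOnTreeIntOther : Prop :=
  ∀ (N : ℕ) [NeZero N] (K : Type) [Field K] [NumberField K] (Dt : ModularParametrizationData W N)
    (H : HeegnerDatum N (NumberField.discr K)) (ιK : K →+* ℂ) (P : (W.baseChange K).toAffine.Point),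
    CellC W p → ¬ W.HasSplitMultiplicativeReductionAtPrime p → W.conductorNorm ℤ = N →
    IsImaginaryQuadratic K → NumberField.discr K < -4 → SatisfiesHeegnerHypothesis N K →
    (W.quadraticTwist (NumberField.discr K : ℚ)).entireLFunction 1 ≠ 0 →
    WeierstrassCurve.Affine.Point.map ιK.toRatAlgHom P = heegnerPointComplex Dt H →
    ¬ (p : ℤ) ∣ Dt.c → ¬ IsOfFinAddOrder P →
    Odd (NumberField.discr K) →
    ∀ (κ : ZpExtension K p), κ.IsAnticyclotomic →
      ∀ (γ : Field.absoluteGaloisGroup K) [Fact (κ.IsTopGenerator γ)]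
        (𝔭 : HeightOneSpectrum (𝓞 K)), ((p : ℕ) : 𝓞 K) ∈ 𝔭.asIdeal →
        𝔭.asIdeal.ramificationIdx (𝓞 ℚ) = 1 → 𝔭.asIdeal.inertiaDeg (𝓞 ℚ) = 1 →
        ∀ (𝔭bar : HeightOneSpectrum (𝓞 K)), ((p : ℕ) : 𝓞 K) ∈ 𝔭bar.asIdeal → 𝔭bar ≠ 𝔭 →
          ((Ideal.span {(p : ℤ)}).primesOver (𝓞 K)).ncard = 2 →
        ∀ (f : CuspForm (CongruenceSubgroup.Gamma0 N) 2), IsNewformOf W f →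
          ∀ (ι' : PadicAlgCl p ≃+* ℂ),
            (∀ (w : InfinitePlace K) (k : 𝓞 K),
              k ∈ 𝔭.asIdeal ↔ ‖ι'.symm (w.embedding (k : K))‖ < 1) →
            ∀ (ΩK : ℂ) (Ωp : ℂ_[p]) (Q : PowerSeries 𝓞_ℂ_[p]), ΩK ≠ 0 → ‖Ωp‖ = 1 →
              R1.IsBDPLFunctionInt p ι' 𝔭 κ γ f ΩK Ωp Q →
                ∃ k : ℕ, PowerSeries.C ((p : 𝓞_ℂ_[p]) ^ k) * Q ∈
                  (XAc.charIdeal (W.baseChange K) p κ 𝔭bar ∅ γ).map (PowerSeries.map (R1.toCpInt p))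

/-- **c3s♭′-div — `SplitKolyvaginDivOnTreeIntOther W p`**: `NonsplitKolyvaginDivOnTreeIntOther` with the
sign flipped (binders = those of `SplitIMCEqOnTreeIntOther W p` VERBATIM). The re-oriented twin of
`SplitKolyvaginDivOnTreeInt W p` (p432153). TYPED, not attempted; nothing asserted.
[claim: KellerYin2024, status: under-review]
[cite: KellerYin2024, §3 and §5.2 (arXiv:2402.12781v2) (shape only; nothing asserted)] -/
@[conjecture]
def SplitKolyvaginDivOnTreeIntOther : Prop :=
  ∀ (N : ℕ) [NeZero N] (K : Type) [Field K] [NumberField K] (Dt : ModularParametrizationData W N)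
    (H : HeegnerDatum N (NumberField.discr K)) (ιK : K →+* ℂ) (P : (W.baseChange K).toAffine.Point),
    CellC W p → W.HasSplitMultiplicativeReductionAtPrime p → W.conductorNorm ℤ = N →
    IsImaginaryQuadratic K → NumberField.discr K < -4 → SatisfiesHeegnerHypothesis N K →
    (W.quadraticTwist (NumberField.discr K : ℚ)).entireLFunction 1 ≠ 0 →
    WeierstrassCurve.Affine.Point.map ιK.toRatAlgHom P = heegnerPointComplex Dt H →
    ¬ (p : ℤ) ∣ Dt.c → ¬ IsOfFinAddOrder P →
    Odd (NumberField.discr K) →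
    ∀ (κ : ZpExtension K p), κ.IsAnticyclotomic →
      ∀ (γ : Field.absoluteGaloisGroup K) [Fact (κ.IsTopGenerator γ)]
        (𝔭 : HeightOneSpectrum (𝓞 K)), ((p : ℕ) : 𝓞 K) ∈ 𝔭.asIdeal →
        𝔭.asIdeal.ramificationIdx (𝓞 ℚ) = 1 → 𝔭.asIdeal.inertiaDeg (𝓞 ℚ) = 1 →
        ∀ (𝔭bar : HeightOneSpectrum (𝓞 K)), ((p : ℕ) : 𝓞 K) ∈ 𝔭bar.asIdeal → 𝔭bar ≠ 𝔭 →
          ((Ideal.span {(p : ℤ)}).primesOver (𝓞 K)).ncard = 2 →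
        ∀ (f : CuspForm (CongruenceSubgroup.Gamma0 N) 2), IsNewformOf W f →
          ∀ (ι' : PadicAlgCl p ≃+* ℂ),
            (∀ (w : InfinitePlace K) (k : 𝓞 K),
              k ∈ 𝔭.asIdeal ↔ ‖ι'.symm (w.embedding (k : K))‖ < 1) →
            ∀ (ΩK : ℂ) (Ωp : ℂ_[p]) (Q : PowerSeries 𝓞_ℂ_[p]), ΩK ≠ 0 → ‖Ωp‖ = 1 →
              R1.IsBDPLFunctionInt p ι' 𝔭 κ γ f ΩK Ωp Q →
                ∃ k : ℕ, PowerSeries.C ((p : 𝓞_ℂ_[p]) ^ k) * Q ∈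
                  (XAc.charIdeal (W.baseChange K) p κ 𝔭bar ∅ γ).map (PowerSeries.map (R1.toCpInt p))

/-- **D′ at `𝔭̄`, non-split — `NonsplitMuLambdaOnTreeIntOther W p`: KELLER–YIN D′ (`μ = 0` AND
`λ`-EQUALITY) read in `𝓞_{ℂ_p}`, X-slot AT THE OTHER PRIME.** Binders = those of
`NonsplitIMCEqOnTreeIntOther W p` VERBATIM; conclusion: for every ♭-frame `Q` at `(ι′, 𝔭)` and every
generator `𝓕` of `Ch_Λ(X_ac^∅ STRICT AT 𝔭̄)`, the first coefficient of norm `1` of `𝓕♭` (read through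
`ℤ_p → 𝓞_{ℂ_p}`) and that of `Q` sit at the SAME index `n` (Washington §7.1: `μ = 0` on both sides and
`λ(𝓕) = λ(Q)`). The re-oriented twin of `NonsplitMuLambdaOnTreeInt W p` (p429473). PRINT: Keller–Yin v2
§5.1, the Lemma "the `μ`-invariants of `𝔛^S_f` and `𝔛^S_{f_m}` are `0`" and `algmain` (λ), for KY's `𝔛_f`
= the tree's `X_ac` strict at `𝔭̄` (RULING L31) — UNREFEREED PREPRINT; consumed as a hypothesis.
[claim: KellerYin2024, status: under-review]
[cite: KellerYin2024, §5.1 (the μ-Lemma and `algmain`) and Thm. 5.1.3 = Thm. D (arXiv:2402.12781v2 L1740–L1756)]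
[cite: Washington1997, §7.1 Prop. 7.2 and §13.2 (μ, λ as first unit coefficient)] -/
@[conjecture]
def NonsplitMuLambdaOnTreeIntOther : Prop :=
  ∀ (N : ℕ) [NeZero N] (K : Type) [Field K] [NumberField K] (Dt : ModularParametrizationData W N)
    (H : HeegnerDatum N (NumberField.discr K)) (ιK : K →+* ℂ) (P : (W.baseChange K).toAffine.Point),
    CellC W p → ¬ W.HasSplitMultiplicativeReductionAtPrime p → W.conductorNorm ℤ = N →
    IsImaginaryQuadratic K → NumberField.discr K < -4 → SatisfiesHeegnerHypothesis N K →
    (W.quadraticTwist (NumberField.discr K : ℚ)).entireLFunction 1 ≠ 0 →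
    WeierstrassCurve.Affine.Point.map ιK.toRatAlgHom P = heegnerPointComplex Dt H →
    ¬ (p : ℤ) ∣ Dt.c → ¬ IsOfFinAddOrder P →
    Odd (NumberField.discr K) →
    ∀ (κ : ZpExtension K p), κ.IsAnticyclotomic →
      ∀ (γ : Field.absoluteGaloisGroup K) [Fact (κ.IsTopGenerator γ)]
        (𝔭 : HeightOneSpectrum (𝓞 K)), ((p : ℕ) : 𝓞 K) ∈ 𝔭.asIdeal →
        𝔭.asIdeal.ramificationIdx (𝓞 ℚ) = 1 → 𝔭.asIdeal.inertiaDeg (𝓞 ℚ) = 1 →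
        ∀ (𝔭bar : HeightOneSpectrum (𝓞 K)), ((p : ℕ) : 𝓞 K) ∈ 𝔭bar.asIdeal → 𝔭bar ≠ 𝔭 →
          ((Ideal.span {(p : ℤ)}).primesOver (𝓞 K)).ncard = 2 →
        ∀ (f : CuspForm (CongruenceSubgroup.Gamma0 N) 2), IsNewformOf W f →
          ∀ (ι' : PadicAlgCl p ≃+* ℂ),
            (∀ (w : InfinitePlace K) (k : 𝓞 K),
              k ∈ 𝔭.asIdeal ↔ ‖ι'.symm (w.embedding (k : K))‖ < 1) →
            ∀ (ΩK : ℂ) (Ωp : ℂ_[p]) (Q : PowerSeries 𝓞_ℂ_[p]), ΩK ≠ 0 → ‖Ωp‖ = 1 →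
              R1.IsBDPLFunctionInt p ι' 𝔭 κ γ f ΩK Ωp Q →
                ∀ F : IwasawaAlgebra p,
                  XAc.charIdeal (W.baseChange K) p κ 𝔭bar ∅ γ = Ideal.span {F} →
                  ∃ n : ℕ,
                    (‖((PowerSeries.coeff n (PowerSeries.map (R1.toCpInt p) F) : 𝓞_ℂ_[p]) : ℂ_[p])‖ = 1 ∧
                      ∀ i < n, ‖((PowerSeries.coeff i (PowerSeries.map (R1.toCpInt p) F) :
                        𝓞_ℂ_[p]) : ℂ_[p])‖ < 1) ∧
                    (‖((PowerSeries.coeff n Q : 𝓞_ℂ_[p]) : ℂ_[p])‖ = 1 ∧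
                      ∀ i < n, ‖((PowerSeries.coeff i Q : 𝓞_ℂ_[p]) : ℂ_[p])‖ < 1)

/-- **D′ at `𝔭̄`, split — `SplitMuLambdaOnTreeIntOther W p`**: `NonsplitMuLambdaOnTreeIntOther` with the
sign flipped (binders = those of `SplitIMCEqOnTreeIntOther W p` VERBATIM; Keller–Yin §5 carries no sign
hypothesis). The re-oriented twin of `SplitMuLambdaOnTreeInt W p` (p432153). UNREFEREED PREPRINT;
consumed as a hypothesis. [claim: KellerYin2024, status: under-review]
[cite: KellerYin2024, §5.1 (the μ-Lemma and `algmain`) and Thm. 5.1.3 = Thm. D (arXiv:2402.12781v2 L1740–L1756), no sign hypothesis] -/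
@[conjecture]
def SplitMuLambdaOnTreeIntOther : Prop :=
  ∀ (N : ℕ) [NeZero N] (K : Type) [Field K] [NumberField K] (Dt : ModularParametrizationData W N)
    (H : HeegnerDatum N (NumberField.discr K)) (ιK : K →+* ℂ) (P : (W.baseChange K).toAffine.Point),
    CellC W p → W.HasSplitMultiplicativeReductionAtPrime p → W.conductorNorm ℤ = N →
    IsImaginaryQuadratic K → NumberField.discr K < -4 → SatisfiesHeegnerHypothesis N K →
    (W.quadraticTwist (NumberField.discr K : ℚ)).entireLFunction 1 ≠ 0 →
    WeierstrassCurve.Affine.Point.map ιK.toRatAlgHom P = heegnerPointComplex Dt H →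
    ¬ (p : ℤ) ∣ Dt.c → ¬ IsOfFinAddOrder P →
    Odd (NumberField.discr K) →
    ∀ (κ : ZpExtension K p), κ.IsAnticyclotomic →
      ∀ (γ : Field.absoluteGaloisGroup K) [Fact (κ.IsTopGenerator γ)]
        (𝔭 : HeightOneSpectrum (𝓞 K)), ((p : ℕ) : 𝓞 K) ∈ 𝔭.asIdeal →
        𝔭.asIdeal.ramificationIdx (𝓞 ℚ) = 1 → 𝔭.asIdeal.inertiaDeg (𝓞 ℚ) = 1 →
        ∀ (𝔭bar : HeightOneSpectrum (𝓞 K)), ((p : ℕ) : 𝓞 K) ∈ 𝔭bar.asIdeal → 𝔭bar ≠ 𝔭 →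
          ((Ideal.span {(p : ℤ)}).primesOver (𝓞 K)).ncard = 2 →
        ∀ (f : CuspForm (CongruenceSubgroup.Gamma0 N) 2), IsNewformOf W f →
          ∀ (ι' : PadicAlgCl p ≃+* ℂ),
            (∀ (w : InfinitePlace K) (k : 𝓞 K),
              k ∈ 𝔭.asIdeal ↔ ‖ι'.symm (w.embedding (k : K))‖ < 1) →
            ∀ (ΩK : ℂ) (Ωp : ℂ_[p]) (Q : PowerSeries 𝓞_ℂ_[p]), ΩK ≠ 0 → ‖Ωp‖ = 1 →
              R1.IsBDPLFunctionInt p ι' 𝔭 κ γ f ΩK Ωp Q →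
                ∀ F : IwasawaAlgebra p,
                  XAc.charIdeal (W.baseChange K) p κ 𝔭bar ∅ γ = Ideal.span {F} →
                  ∃ n : ℕ,
                    (‖((PowerSeries.coeff n (PowerSeries.map (R1.toCpInt p) F) : 𝓞_ℂ_[p]) : ℂ_[p])‖ = 1 ∧
                      ∀ i < n, ‖((PowerSeries.coeff i (PowerSeries.map (R1.toCpInt p) F) :
                        𝓞_ℂ_[p]) : ℂ_[p])‖ < 1) ∧
                    (‖((PowerSeries.coeff n Q : 𝓞_ℂ_[p]) : ℂ_[p])‖ = 1 ∧
                      ∀ i < n, ‖((PowerSeries.coeff i Q : 𝓞_ℂ_[p]) : ℂ_[p])‖ < 1)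

/-- **Road H at `𝔭̄` — `HidaLimitRevDivOnTreeIntOther W p`: the REVERSE one-sided divisibility
"`p^a · Ch_Λ(X_ac^∅(E[p^∞]) STRICT AT 𝔭̄)·𝓞_{ℂ_p}⟦T⟧ ⊆ (Q)`" over `𝓞_{ℂ_p}`-frames at `(ι′, 𝔭)`, BOTH
signs** (binders = those of `NonsplitIMCEqOnTreeIntOther W p` minus the sign): for every X2c Heegner
datum with `D_K` odd and `(p) = 𝔭𝔭̄` split, every ♭-frame `Q` at `(ι′, 𝔭)` and every generator `𝓕` of
`Ch_Λ(X_ac^∅ strict at 𝔭̄)`: `∃ a, p^a · 𝓕♭ ∈ (Q)` in `𝓞_{ℂ_p}⟦T⟧`. The re-oriented twin of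
`HidaLimitRevDivOnTreeInt W p` (p429473, X-slot at `𝔭` = the conjugate statement). PROVENANCE (road H;
NOT in print as one statement): Keller–Yin v2 §5.1 (a)–(e) following Skinner 2016 §3.1 — (b) from
Castella JIMJ 2020 Thm. 2.11, (d) from KY Thm. 3.0.8 for the good members — as repaired by bsd-eis-ky
MEMO-2 "Thm. D″" (input (α) lattice congruences, cgshw MEMO-9) and kernel-checked over `ℤ_p⟦T⟧` as
`X2.KellerYinFreePartGap.charIdeal_eq_span_of_oneSided_congruences`; in print's terms this is the
direction of KY §5.1's second Lemma "`Char(𝔛^S_f)Λ^nr = (𝓛^S_f)`" read one-sidedly through Lemma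
5.1.2, `𝔛_f` = the tree's `X_ac` strict at `𝔭̄` (RULING L31). PRE / unprinted at member level; a
predicate on `(W, p)`; TYPED, not attempted; nothing asserted; every result using it is CONDITIONAL.
[claim: KellerYin2024, status: under-review]
[cite: KellerYin2024, §5.1 (a)–(e), Lemma 5.1.2, Thm. 5.1.3 = Thm. D and Thm. 3.0.8 (arXiv:2402.12781v2 L1725–L1770)]
[cite: Skinner2016PacificMC, §3.1 (p. 192) (shape of the congruence limit)] -/
@[conjecture]
def HidaLimitRevDivOnTreeIntOther : Prop :=
  ∀ (N : ℕ) [NeZero N] (K : Type) [Field K] [NumberField K] (Dt : ModularParametrizationData W N)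
    (H : HeegnerDatum N (NumberField.discr K)) (ιK : K →+* ℂ) (P : (W.baseChange K).toAffine.Point),
    CellC W p → W.conductorNorm ℤ = N →
    IsImaginaryQuadratic K → NumberField.discr K < -4 → SatisfiesHeegnerHypothesis N K →
    (W.quadraticTwist (NumberField.discr K : ℚ)).entireLFunction 1 ≠ 0 →
    WeierstrassCurve.Affine.Point.map ιK.toRatAlgHom P = heegnerPointComplex Dt H →
    ¬ (p : ℤ) ∣ Dt.c → ¬ IsOfFinAddOrder P →
    Odd (NumberField.discr K) →
    ∀ (κ : ZpExtension K p), κ.IsAnticyclotomic →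
      ∀ (γ : Field.absoluteGaloisGroup K) [Fact (κ.IsTopGenerator γ)]
        (𝔭 : HeightOneSpectrum (𝓞 K)), ((p : ℕ) : 𝓞 K) ∈ 𝔭.asIdeal →
        𝔭.asIdeal.ramificationIdx (𝓞 ℚ) = 1 → 𝔭.asIdeal.inertiaDeg (𝓞 ℚ) = 1 →
        ∀ (𝔭bar : HeightOneSpectrum (𝓞 K)), ((p : ℕ) : 𝓞 K) ∈ 𝔭bar.asIdeal → 𝔭bar ≠ 𝔭 →
          ((Ideal.span {(p : ℤ)}).primesOver (𝓞 K)).ncard = 2 →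
        ∀ (f : CuspForm (CongruenceSubgroup.Gamma0 N) 2), IsNewformOf W f →
          ∀ (ι' : PadicAlgCl p ≃+* ℂ),
            (∀ (w : InfinitePlace K) (k : 𝓞 K),
              k ∈ 𝔭.asIdeal ↔ ‖ι'.symm (w.embedding (k : K))‖ < 1) →
            ∀ (ΩK : ℂ) (Ωp : ℂ_[p]) (Q : PowerSeries 𝓞_ℂ_[p]), ΩK ≠ 0 → ‖Ωp‖ = 1 →
              R1.IsBDPLFunctionInt p ι' 𝔭 κ γ f ΩK Ωp Q →
                ∀ F : IwasawaAlgebra p,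
                  XAc.charIdeal (W.baseChange K) p κ 𝔭bar ∅ γ = Ideal.span {F} →
                  ∃ a : ℕ, PowerSeries.C ((p : 𝓞_ℂ_[p]) ^ a) * PowerSeries.map (R1.toCpInt p) F ∈
                    Ideal.span ({Q} : Set (PowerSeries 𝓞_ℂ_[p]))

end ResidualsIntOther

/-! ### §2 Glue: either divisibility half + D′ ⟹ the re-oriented atom, each sign -/

section GlueOther

variable {W : WeierstrassCurve ℚ} [W.IsElliptic] [W.IsGloballyMinimal] {p : ℕ} [Fact p.Prime]

omit [W.IsElliptic] [W.IsGloballyMinimal] in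
/-- **c3♭′ from its Kolyvagin halves, in the kernel: c3♭′-div + D′ at `𝔭̄` ⟹
`NonsplitIMCEqOnTreeIntOther W p`** — p429473's `nonsplitIMCEqOnTreeInt_of_divInt_of_muLambdaInt` with
`𝔭 ↦ 𝔭̄` in the X-slot (`X2.CpIntSeries.span_singleton_eq_of_C_pow_mul_mem` + principality of
characteristic ideals). CONDITIONAL on the two typed halves; nothing booked.
[cite: KellerYin2024, proof of Thm. 3.0.8 (the closing by μ = 0 and λ) (arXiv:2402.12781v2)] [cite: Washington1997, §7.1 Prop. 7.2] -/
theorem nonsplitIMCEqOnTreeIntOther_of_divIntOther_of_muLambdaIntOther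
    (hdiv : NonsplitKolyvaginDivOnTreeIntOther W p) (hml : NonsplitMuLambdaOnTreeIntOther W p) :
    NonsplitIMCEqOnTreeIntOther W p := by
  intro N _ K _ _ Dt H ιK P hc hns hN hK hd4 hHN hLt hP hcM hPinf hodd κ hκ γ _ 𝔭 h𝔭 he hf 𝔭bar h𝔭bar
    hne hsplit f hfW ι' hι' ΩK Ωp Q hΩK hΩp hQ
  obtain ⟨k, hk⟩ := hdiv N K Dt H ιK P hc hns hN hK hd4 hHN hLt hP hcM hPinf hodd κ hκ γ 𝔭 h𝔭 he hf
    𝔭bar h𝔭bar hne hsplit f hfW ι' hι' ΩK Ωp Q hΩK hΩp hQ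
  obtain ⟨F, hF⟩ :=
    (charIdeal_isPrincipal_holds p (XAc (W.baseChange K) p κ 𝔭bar ∅ γ)).principal
  have hchar : XAc.charIdeal (W.baseChange K) p κ 𝔭bar ∅ γ = Ideal.span {F} := hF
  obtain ⟨n, hFn, hQn⟩ := hml N K Dt H ιK P hc hns hN hK hd4 hHN hLt hP hcM hPinf hodd κ hκ γ 𝔭 h𝔭
    he hf 𝔭bar h𝔭bar hne hsplit f hfW ι' hι' ΩK Ωp Q hΩK hΩp hQ F hchar
  unfold R1.IMCEqIntAt
  rw [hchar, Ideal.map_span, Set.image_singleton] at hk ⊢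
  exact CpIntSeries.span_singleton_eq_of_C_pow_mul_mem hk hFn hQn

omit [W.IsElliptic] [W.IsGloballyMinimal] in
/-- **c3♭′ from the Hida-limit road, in the kernel: `HidaLimitRevDivOnTreeIntOther` + D′ at `𝔭̄` ⟹
`NonsplitIMCEqOnTreeIntOther W p`** — p429473's `nonsplitIMCEqOnTreeInt_of_hidaLimitRevDivInt_of_muLambdaInt`
with `𝔭 ↦ 𝔭̄` in the X-slot (the same algebra with the roles of `𝓕♭` and `Q` exchanged). CONDITIONAL on
the two typed hypotheses; nothing booked.
[cite: KellerYin2024, Lemma 5.1.2 and §5.1 (arXiv:2402.12781v2)] [cite: Washington1997, §7.1 Prop. 7.2] -/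
theorem nonsplitIMCEqOnTreeIntOther_of_hidaLimitRevDivIntOther_of_muLambdaIntOther
    (hrev : HidaLimitRevDivOnTreeIntOther W p) (hml : NonsplitMuLambdaOnTreeIntOther W p) :
    NonsplitIMCEqOnTreeIntOther W p := by
  intro N _ K _ _ Dt H ιK P hc hns hN hK hd4 hHN hLt hP hcM hPinf hodd κ hκ γ _ 𝔭 h𝔭 he hf 𝔭bar h𝔭bar
    hne hsplit f hfW ι' hι' ΩK Ωp Q hΩK hΩp hQ
  obtain ⟨F, hF⟩ :=
    (charIdeal_isPrincipal_holds p (XAc (W.baseChange K) p κ 𝔭bar ∅ γ)).principal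
  have hchar : XAc.charIdeal (W.baseChange K) p κ 𝔭bar ∅ γ = Ideal.span {F} := hF
  obtain ⟨a, ha⟩ := hrev N K Dt H ιK P hc hN hK hd4 hHN hLt hP hcM hPinf hodd κ hκ γ 𝔭 h𝔭 he hf 𝔭bar
    h𝔭bar hne hsplit f hfW ι' hι' ΩK Ωp Q hΩK hΩp hQ F hchar
  obtain ⟨n, hFn, hQn⟩ := hml N K Dt H ιK P hc hns hN hK hd4 hHN hLt hP hcM hPinf hodd κ hκ γ 𝔭 h𝔭
    he hf 𝔭bar h𝔭bar hne hsplit f hfW ι' hι' ΩK Ωp Q hΩK hΩp hQ F hchar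
  unfold R1.IMCEqIntAt
  rw [hchar, Ideal.map_span, Set.image_singleton]
  exact (CpIntSeries.span_singleton_eq_of_C_pow_mul_mem ha hQn hFn).symm

omit [W.IsElliptic] [W.IsGloballyMinimal] in
/-- **Either divisibility half suffices (non-split)**: `(c3♭′-div ∨ HidaLimitRevDivOnTreeIntOther) ∧
D′ ⟹ c3♭′`. CONDITIONAL; nothing booked. [folklore] -/
theorem nonsplitIMCEqOnTreeIntOther_of_divIntOther_or_hidaLimitRevDivIntOther_of_muLambdaIntOther
    (hdiv : NonsplitKolyvaginDivOnTreeIntOther W p ∨ HidaLimitRevDivOnTreeIntOther W p)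
    (hml : NonsplitMuLambdaOnTreeIntOther W p) : NonsplitIMCEqOnTreeIntOther W p := by
  rcases hdiv with hd | hrev
  · exact nonsplitIMCEqOnTreeIntOther_of_divIntOther_of_muLambdaIntOther hd hml
  · exact nonsplitIMCEqOnTreeIntOther_of_hidaLimitRevDivIntOther_of_muLambdaIntOther hrev hml

omit [W.IsElliptic] [W.IsGloballyMinimal] in
/-- **c3s♭′ from its Kolyvagin halves: c3s♭′-div + D′ at `𝔭̄` ⟹ `SplitIMCEqOnTreeIntOther W p`**
(p432153's `splitIMCEqOnTreeInt_of_divInt_of_muLambdaInt` with `𝔭 ↦ 𝔭̄` in the X-slot). CONDITIONAL;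
nothing booked.
[cite: KellerYin2024, proof of Thm. 3.0.8 (the closing by μ = 0 and λ) (arXiv:2402.12781v2)] [cite: Washington1997, §7.1 Prop. 7.2] -/
theorem splitIMCEqOnTreeIntOther_of_divIntOther_of_muLambdaIntOther
    (hdiv : SplitKolyvaginDivOnTreeIntOther W p) (hml : SplitMuLambdaOnTreeIntOther W p) :
    SplitIMCEqOnTreeIntOther W p := by
  intro N _ K _ _ Dt H ιK P hc hs hN hK hd4 hHN hLt hP hcM hPinf hodd κ hκ γ _ 𝔭 h𝔭 he hf 𝔭bar h𝔭bar
    hne hsplit f hfW ι' hι' ΩK Ωp Q hΩK hΩp hQ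
  obtain ⟨k, hk⟩ := hdiv N K Dt H ιK P hc hs hN hK hd4 hHN hLt hP hcM hPinf hodd κ hκ γ 𝔭 h𝔭 he hf
    𝔭bar h𝔭bar hne hsplit f hfW ι' hι' ΩK Ωp Q hΩK hΩp hQ
  obtain ⟨F, hF⟩ :=
    (charIdeal_isPrincipal_holds p (XAc (W.baseChange K) p κ 𝔭bar ∅ γ)).principal
  have hchar : XAc.charIdeal (W.baseChange K) p κ 𝔭bar ∅ γ = Ideal.span {F} := hF
  obtain ⟨n, hFn, hQn⟩ := hml N K Dt H ιK P hc hs hN hK hd4 hHN hLt hP hcM hPinf hodd κ hκ γ 𝔭 h𝔭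
    he hf 𝔭bar h𝔭bar hne hsplit f hfW ι' hι' ΩK Ωp Q hΩK hΩp hQ F hchar
  unfold R1.IMCEqIntAt
  rw [hchar, Ideal.map_span, Set.image_singleton] at hk ⊢
  exact CpIntSeries.span_singleton_eq_of_C_pow_mul_mem hk hFn hQn

omit [W.IsElliptic] [W.IsGloballyMinimal] in
/-- **Road H at `𝔭̄` closes c3s♭′: `HidaLimitRevDivOnTreeIntOther` (sign-free) + D′ at `𝔭̄` ⟹
`SplitIMCEqOnTreeIntOther W p`** (p432153's `splitIMCEqOnTreeInt_of_hidaLimitRevDivInt_of_muLambdaInt`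
with `𝔭 ↦ 𝔭̄` in the X-slot). CONDITIONAL; nothing booked.
[cite: KellerYin2024, Lemma 5.1.2 and §5.1 (arXiv:2402.12781v2)] [cite: Washington1997, §7.1 Prop. 7.2] -/
theorem splitIMCEqOnTreeIntOther_of_hidaLimitRevDivIntOther_of_muLambdaIntOther
    (hrev : HidaLimitRevDivOnTreeIntOther W p) (hml : SplitMuLambdaOnTreeIntOther W p) :
    SplitIMCEqOnTreeIntOther W p := by
  intro N _ K _ _ Dt H ιK P hc hs hN hK hd4 hHN hLt hP hcM hPinf hodd κ hκ γ _ 𝔭 h𝔭 he hf 𝔭bar h𝔭bar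
    hne hsplit f hfW ι' hι' ΩK Ωp Q hΩK hΩp hQ
  obtain ⟨F, hF⟩ :=
    (charIdeal_isPrincipal_holds p (XAc (W.baseChange K) p κ 𝔭bar ∅ γ)).principal
  have hchar : XAc.charIdeal (W.baseChange K) p κ 𝔭bar ∅ γ = Ideal.span {F} := hF
  obtain ⟨a, ha⟩ := hrev N K Dt H ιK P hc hN hK hd4 hHN hLt hP hcM hPinf hodd κ hκ γ 𝔭 h𝔭 he hf 𝔭bar
    h𝔭bar hne hsplit f hfW ι' hι' ΩK Ωp Q hΩK hΩp hQ F hchar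
  obtain ⟨n, hFn, hQn⟩ := hml N K Dt H ιK P hc hs hN hK hd4 hHN hLt hP hcM hPinf hodd κ hκ γ 𝔭 h𝔭
    he hf 𝔭bar h𝔭bar hne hsplit f hfW ι' hι' ΩK Ωp Q hΩK hΩp hQ F hchar
  unfold R1.IMCEqIntAt
  rw [hchar, Ideal.map_span, Set.image_singleton]
  exact (CpIntSeries.span_singleton_eq_of_C_pow_mul_mem ha hQn hFn).symm

omit [W.IsElliptic] [W.IsGloballyMinimal] in
/-- **Either divisibility half suffices (split)**: `(c3s♭′-div ∨ HidaLimitRevDivOnTreeIntOther) ∧ D′ ⟹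
c3s♭′`. CONDITIONAL; nothing booked. [folklore] -/
theorem splitIMCEqOnTreeIntOther_of_divIntOther_or_hidaLimitRevDivIntOther_of_muLambdaIntOther
    (hdiv : SplitKolyvaginDivOnTreeIntOther W p ∨ HidaLimitRevDivOnTreeIntOther W p)
    (hml : SplitMuLambdaOnTreeIntOther W p) : SplitIMCEqOnTreeIntOther W p := by
  rcases hdiv with hd | hrev
  · exact splitIMCEqOnTreeIntOther_of_divIntOther_of_muLambdaIntOther hd hml
  · exact splitIMCEqOnTreeIntOther_of_hidaLimitRevDivIntOther_of_muLambdaIntOther hrev hml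

end GlueOther

end Summit.BirchSwinnertonDyer.Rank1Residual.X2

end
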